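import Literature.MathematicalPhysics.QuantumFieldTheory.Balaban1983to89.B6Prop25TwoScaleCensus
import Literature.MathematicalPhysics.QuantumFieldTheory.Balaban1983to89.B6Prop26Gluing

/-!
# `Balaban1983to89.B6Ineq2133TwoScaleV1` — T. Bałaban, *Propagators and renormalization transformations for lattice gauge theories. II*,
# Commun. Math. Phys. **96** (1984) 223–250 [Balaban1984PropagatorsII], THE INEQUALITY (2.133) p. 247 FOR THE GENUINE TWO-SCALE `G_□` OF (2.90)
# (`tsV1`, `Λ′ ⊂ T^{(j+1)}` ARBITRARY), IN THE MAJORANT SHAPE CONSUMED BY THE GLUING OF PROPOSITION 2.6 (`B6Prop26Gluing`)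

statement-level skeleton of published theorems with citation tags; proofs where landed; nothing here is a claim about the Yang–Mills mass gap

PDF held: `paper:balaban1984-cmp96-propagators-rt-ii` (journal page = PDF page + 222), p. 247 [PDF 25]; p. 239 [PDF 17].  PRINT.  p. 247 (verbatim,
as quoted in the tree's `B6Eq294Scaling`/`B6Prop26Gluing`): *"Now let us come back to the equality (2.91). At first we will formulate the relevant
inequalities for G_□ rescaled back to η-scale. We have |(G_□J)(x)|, |(∇G_□J)(x)| ≤ O(1)[(L^jη)², L^jη]e^{−δ₂(L^jη)^{−1}dist(Δ,Δ′)}|J|, (2.133) for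
x ∈ Δ(y), supp J ⊂ Δ(y′), y, y′ ∈ 𝔅 ∩ T_□."*  p. 239: *"We form an approximation of G taking as usual G₀ = Σ_{□∈𝒟} h_□G_□h_□."*

CITATION HEADER (lean-in-tree rule) — WHAT IS REPRODUCED.  Phase-2 file of the `lit-balaban` typed skeleton (HOME `run/shared/lean/pub/lit-balaban/`),
seat **p38 gen 23**; owner-named target (B6 fold owner r03 gen 17, 2026-08-22T19:23Z, «bite (a)» of B6-CLOSURE §3.7 (iii)); SKELETON rows
**B6.Eq2.133** × **B6.Prop2.5** × **B6.Prop2.6** (cells only; decls of record untouched).  (2.133) is Proposition 2.5's sup member (1.110)₁ (and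
(1.110)₂ for the derivative) for the block operator `G_□`; the gluing step of Proposition 2.6 (`…B6Prop26Gluing.prop26_2136_of_2133_2134_lemma21`,
hypothesis `h2133`) consumes it in the MAJORANT shape of `…B6RandomWalk.HasMajorant` / `…B6Prop26Gluing.LocalMajorant`: for every source `μ`
supported in ONE block `y′` with `|μ| ≤ B`, `|(G_□μ)(x)| ≤ K(y(x), y′)·B` for every `x`.  THIS FILE proves exactly that shape for every member of the
GENUINE two-scale family of (2.90) — r03's census index `…B6Prop25TwoScaleCensus.TSIdx` (volume `(m, K)`, scale `j + 1 ≤ m + K`, `Λ′ ⊂ T^{(j+1)}`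
arbitrary, weights `a₀(L^j)^{d+1} ≤ w ≤ a₁(L^j)^{d+1}`; data `i.D = tsV1 …`):
* `tsGeo i R M : B6.Geometry` — the geometry of ONE two-scale step: sites = the unit lattice `T^{(j)}` (the `j`-blocks), `dist` = the torus sup
  distance `|y − y′|_T` (r03's `TSIdx.tdist`, p22's `torusSupNorm`), all sites at scale `j`, `η := (L^j)⁻¹` (so `L^jη = 1`: the `ξ`-lattice units of
  `T_□`, [4]'s convention), `R`, `M` carried as parameters, (2.1)–(2.2) void (`Hyp21_22 := True`), the localisation/norm/cut-off fields = the census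
  setting's (`TSIdx.suppInTS`, `supNormTS`, `l2NormTS`, `holderTS`, `cutInTS`, `hqS + cutSupTS`, `cutSupTS`); API `tsGeo_len` (`L^jη = 1`),
  `tsGeo_triangle` ((2.54), the gluing theorem's `htri`), `tsGeo_dist_self` (`hrefl`), `tsGeo_dist_comm`, `tsGeo_dist_nonneg` (`hdnn`);
* `onFun f` — a linear map of Euclidean spaces `ℓ²(ι) → ℓ²(κ)` read on the function carriers `(ι → ℝ) → (κ → ℝ)` of `B6RandomWalk` through
  `WithLp.linearEquiv` (the inverse reading of `B6SectAOperatorsV1.onE`; `onFun_apply`, `onFun_onE`), so `T := onFun G_□ : Module.End ℝ (PBond P 0 → ℝ)`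
  (dictionary lemma `T_apply_eq_G`: `(Tμ)(x) = (G_□(toLp μ))(x)`); the block map is `b ↦ y(b₋) ∈ T^{(j)}` (`fun b : PBond P 0 => iterBlockOf j b.src`,
  literally, as in the owner's brief);
* **`ineq2133_G`**: ONE `δ₂ > 0` and ONE `A ≥ 0` (on `d, L, a₀, a₁` only) with
  `HasMajorant (fun b => iterBlockOf j b.src) (onFun G_□) (fun y y′ => A·e^{−δ₂|y − y′|_T})` for EVERY member `i` (and every `R`, `M`) — from p22's block bound
  `…B6Prop25DecayTwoScaleV1.blockBound_G_scaling` BY NAME (the (1.110)₁ member of Prop. 2.5 for the two-scale `G_□`) and the tree's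
  `…B6BlockDecayCalculus.abs_apply_le_of_blockBound`;
* **`ineq2133_DG`**: the same for `∇_λG_□` (`onFun (∇_λ ∘ G_□)`, every direction `λ`; p22's `blockBound_DG_scaling`, the (1.110)₂ member);
* **`ineq2133`**: both entries with ONE pair `(δ₂, A)` (as printed: one `O(1)`, one `δ₂`; `min`/`max` + `B6RandomWalk.hasMajorant_mono`);
* `ineq2133_G_local`, `ineq2133_DG_local`: the `LocalMajorant` forms on an arbitrary reach set `S` (`localMajorant_of_hasMajorant`) — the shape of
  the hypothesis `h2133` of `prop26_2136_of_2133_2134_lemma21` (`Gl □ := onFun G_□`, weight `P ≡ 1`).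
IMPORTS BY NAME, restating nothing; two `def`s with bodies (`tsGeo`, `onFun`); NO `def … : Prop`, no new hypothesis;
standard axioms.  HONEST SCOPE / DIVERGENCES. (1) This is (2.133) for ONE two-scale step, on `T^{(j)}` with the TORUS SUP DISTANCE of the blocks, in the
`ξ`-lattice units of `T_□` (`L^jη = 1`, the tree's units for Prop. 2.5; the rescaling to the `η`-lattice — the printed factors `(L^jη)²`, `L^jη` and
`(L^jη)^{−1}` in the exponent — is r03's `…B6Eq294Scaling.ineq2133_sup`/`ineq2133_grad`, an implication on scalar site fields, NOT re-derived here).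
(2) The comparison of the torus distance `|y − y′|_T` with the multiscale distance `d(y, y′)` of a k-level cover inside the reach of one box (cell GAPS
G-pv08-1 / G-pv01-5 (i)) is NOT claimed — that identification + the choice of the cover/partition `{h_□}` ((2.36); p21's
`B6Cover236MultiLevelBlocks` / `geom D`) is the owner's design step (c) (B6-CLOSURE §5, after census v1.7 `prop25Printed_TS`). (3) The majorant holds for ALL pairs
`(y(x), y′)` (a global `HasMajorant`), which is stronger than the local shape (2.133) asks for (`y, y′ ∈ 𝔅 ∩ T_□`). (4) `∇_λ = L^j(S_λ − I)` (p22's,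
one component at a time); constants depend on `d, L, a₀, a₁` (print: «O(1)», `δ₂(d, L)` at `a = 1`).  NOT summit progress.  Unit `lit-balaban-p38`
(gen 23), 2026-08-22.
-/

noncomputable section

open scoped BigOperators
open Finset

namespace Literature.MathematicalPhysics.QuantumFieldTheory.Balaban1983to89.B6Ineq2133TwoScaleV1

open LatticeFieldCalculus B5Eq117TorusCarriers B6SectAOperatorsV1 B6SectCOperators B6SectCTwoScaleV1 B6SectCTwoScaleV1Lattice
open BalabanImbrieJaffe1984to88.BIJ85AxialPropagator411 (BondSpace)
open B4TorusKernel.MultiPeriod (torusSupNorm torusSupNorm_nonneg)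
open B6LowerBound2153Torus (rep)
open B5Eq118OneStroke (iterBlockOf)
open B6RandomWalk (HasMajorant BlockSupp)
open B6Prop26Gluing (LocalMajorant localMajorant_of_hasMajorant)
open B6BlockDecayCalculus (abs_apply_le_of_blockBound torusDist_isPseudoDist)
open B6Prop25DecayTwoScaleV1 (blockBound_G_scaling)
open B6Prop25GradDecayTwoScaleV1 (blockBound_DG_scaling)
open B6Prop25TwoScaleCensus (TSIdx)

variable {d L : ℕ} {hd : 1 ≤ d + 1} {hL : Odd L ∧ 1 < L} {a₀ a₁ : ℝ}

/-! ## §1  The geometry of one two-scale step and the transport of `G_□` to the function carrier -/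

/-- **THE GEOMETRY OF ONE TWO-SCALE STEP** (a `B6.Geometry`): sites = the unit lattice `T^{(j)}` of the member (its `j`-blocks `y`), `dist y y′ =
|y − y′|_T` (torus sup distance), every site at scale `j`, `η = (L^j)⁻¹` (`L^jη = 1`), `R`, `M` carried as parameters, (2.1)–(2.2) void; localisation,
norms and cut-offs = the census setting's (`B6Prop25TwoScaleCensus.TSIdx.settingTS`).
[cite: Balaban1984PropagatorsII, (2.133) p.247 («y, y′ ∈ 𝔅 ∩ T_□»), (2.3)–(2.4) p.224, dictionary] -/
@[reducible] def tsGeo (i : TSIdx d L hd hL a₀ a₁) (R M : ℝ) : B6.Geometry where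
  Site := Site i.P i.j
  fin := inferInstance
  scale := fun _ => i.j
  dist := i.tdist
  k := i.j
  eta := ((L : ℝ) ^ i.j)⁻¹
  L := L
  R := R
  M := M
  Hyp21_22 := True
  Loc := i.LocTS
  suppIn := i.suppInTS
  supNorm := i.supNormTS
  l2Norm := i.l2NormTS
  holder := i.holderTS
  Cut := Site i.P 0 → ℝ
  cutIn := i.cutInTS
  cutH := fun α ζ => i.hqS α ζ + i.cutSupTS ζ
  cutSup := i.cutSupTS

/-- `L^jη = 1` for the two-scale step (the `ξ`-lattice units of `T_□`). [cite: Balaban1984PropagatorsII, (2.94) p.239, dictionary] -/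
theorem tsGeo_len (i : TSIdx d L hd hL a₀ a₁) (R M : ℝ) (y : (tsGeo i R M).Site) : (tsGeo i R M).len y = 1 := by
  have hL0 : (L : ℝ) ≠ 0 := Nat.cast_ne_zero.mpr (by have := hL.2; omega)
  show (L : ℝ) ^ i.j * ((L : ℝ) ^ i.j)⁻¹ = 1
  exact mul_inv_cancel₀ (pow_ne_zero _ hL0)

/-- the torus distance of `tsGeo` satisfies the triangle inequality (2.54) — the hypothesis `htri` of
`…B6Prop26Gluing.prop26_2136_of_2133_2134_lemma21` (p22's `B6BlockDecayCalculus.torusDist_isPseudoDist`).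
[cite: Balaban1984PropagatorsII, (2.54) p.233; Balaban1984PropagatorsI, (1.29) p.23 (torus distance), dictionary] -/
theorem tsGeo_triangle (i : TSIdx d L hd hL a₀ a₁) (R M : ℝ) : B6RandomWalk.Triangle254 (tsGeo i R M) :=
  fun a b c => (torusDist_isPseudoDist (Mk i.P i.j)).triangle a b c

/-- `d(y, y) = 0` for the torus distance of `tsGeo` (the hypothesis `hrefl` of the gluing theorem). [cite: Balaban1984PropagatorsI, (1.29) p.23, dictionary] -/
theorem tsGeo_dist_self (i : TSIdx d L hd hL a₀ a₁) (R M : ℝ) (y : (tsGeo i R M).Site) : (tsGeo i R M).dist y y = 0 :=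
  (torusDist_isPseudoDist (Mk i.P i.j)).zero y

/-- symmetry of the torus distance of `tsGeo`. [cite: Balaban1984PropagatorsI, (1.29) p.23, dictionary] -/
theorem tsGeo_dist_comm (i : TSIdx d L hd hL a₀ a₁) (R M : ℝ) (y y' : (tsGeo i R M).Site) :
    (tsGeo i R M).dist y y' = (tsGeo i R M).dist y' y :=
  (torusDist_isPseudoDist (Mk i.P i.j)).symm y y'

/-- `0 ≤ d(y, y′)` for the torus distance of `tsGeo` (the hypothesis `hdnn` of the gluing theorem; r03's `TSIdx.tdist_nonneg`).
[cite: Balaban1984PropagatorsI, (1.29) p.23, dictionary] -/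
theorem tsGeo_dist_nonneg (i : TSIdx d L hd hL a₀ a₁) (R M : ℝ) (y y' : (tsGeo i R M).Site) : 0 ≤ (tsGeo i R M).dist y y' :=
  i.tdist_nonneg y y'

section Wrap

variable {ι κ : Type*}

/-- **transport of a linear map of Euclidean spaces `ℓ²(ι) → ℓ²(κ)` to the function carriers `(ι → ℝ) → (κ → ℝ)`** of `B6RandomWalk.HasMajorant`
(through `WithLp.linearEquiv`; the inverse reading of `B6SectAOperatorsV1.onE`).  Used on `G_□ : BondSpace P →ₗ BondSpace P`,
`BondSpace P = ℓ²(PBond P 0)`. [folklore] -/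
def onFun (f : EuclideanSpace ℝ ι →ₗ[ℝ] EuclideanSpace ℝ κ) : (ι → ℝ) →ₗ[ℝ] (κ → ℝ) :=
  (WithLp.linearEquiv 2 ℝ (κ → ℝ)).toLinearMap ∘ₗ f ∘ₗ (WithLp.linearEquiv 2 ℝ (ι → ℝ)).symm.toLinearMap

/-- components: `onFun f μ x = (f (toLp μ))(x)` (the bond-function reading of an operator of `ℓ²`, as `G_□J` in (2.133)).
[cite: Balaban1984PropagatorsII, (2.90) p.239 («the operator G_□»), (2.133) p.247, dictionary] -/
@[simp] theorem onFun_apply (f : EuclideanSpace ℝ ι →ₗ[ℝ] EuclideanSpace ℝ κ) (μ : ι → ℝ) (x : κ) :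
    onFun f μ x = f (WithLp.toLp 2 μ) x := rfl

/-- `onFun` inverts `B6SectAOperatorsV1.onE` (the tree's reading of function-space maps on `ℓ²`, (2.8)) on the nose.
[cite: Balaban1984PropagatorsII, (2.8) p.224, (2.90) p.239, dictionary] -/
@[simp] theorem onFun_onE (f : (ι → ℝ) →ₗ[ℝ] (κ → ℝ)) : onFun (onE f) = f := rfl

end Wrap

/-- **`T_apply_eq_G`** (the dictionary lemma): the transported `G_□`, `T := onFun G_□ : Module.End ℝ (PBond P 0 → ℝ)`, evaluated —
`(Tμ)(x) = (G_□(toLp μ))(x)` with `G_□ = (tsV1 hc Λ′ w).G` the genuine two-scale operator (2.90) of the member.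
[cite: Balaban1984PropagatorsII, (2.90) p.239 («the operator G_□»), dictionary] -/
theorem T_apply_eq_G (i : TSIdx d L hd hL a₀ a₁) (μ : PBond i.P 0 → ℝ) (x : PBond i.P 0) :
    (onFun i.D.G : Module.End ℝ (PBond i.P 0 → ℝ)) μ x = (tsV1 (P := i.P) i.hc i.Λ' i.w).G (WithLp.toLp 2 μ) x := rfl

/-! ## §2  From a block bound to the majorant shape -/

open Classical in
/-- **BLOCK BOUND ⇒ MAJORANT**: if the operator `f` of the bond space has the block bound `(C, δ)` with respect to the `j`-blocks and the torus
distance — `Σ_{b′ : y(b′₋) = y′}|f(e_{b′})(b)| ≤ C·e^{−δ|y(b₋) − y′|_T}` — then `onFun f` has the majorant `C·e^{−δ|y − y′|_T}` in the sense of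
`B6RandomWalk.HasMajorant`: `|(fμ)(x)| ≤ C·e^{−δ|y(x) − y′|_T}·B` for `μ` supported in the block `y′` with `|μ| ≤ B`.
[cite: Balaban1984PropagatorsII, (2.133) p.247 («for x ∈ Δ(y), supp J ⊂ Δ(y′)»); Balaban1984PropagatorsI, (1.110) p.35 (shape; derivation ours)] -/
theorem hasMajorant_of_blockBound (i : TSIdx d L hd hL a₀ a₁) (R M : ℝ) (f : BondSpace i.P →ₗ[ℝ] BondSpace i.P) {C δ : ℝ}
    (hf : ∀ (b : PBond i.P 0) (y : Site i.P i.j),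
      ∑ b' ∈ univ.filter (fun b' : PBond i.P 0 => iterBlockOf i.j b'.src = y), |f (EuclideanSpace.single b' (1 : ℝ)) b| ≤
        C * Real.exp (-(δ * i.tdist (iterBlockOf i.j b.src) y))) :
    HasMajorant (g := tsGeo i R M) (fun b : PBond i.P 0 => iterBlockOf i.j b.src) (onFun f)
      (fun y y' => C * Real.exp (-(δ * i.tdist y y'))) := by
  intro y' μ B hμ x
  -- the block profile of `μ`: `B` on the block `y′`, `0` elsewhere
  have hg0 : ∀ y : Site i.P i.j, 0 ≤ (if y = y' then B else 0) := fun y => by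
    split_ifs
    · exact hμ.nonneg
    · exact le_rfl
  have hxg : ∀ b' : PBond i.P 0, |(WithLp.toLp 2 μ : BondSpace i.P) b'| ≤ (if iterBlockOf i.j b'.src = y' then B else 0) := fun b' => by
    by_cases hb : iterBlockOf i.j b'.src = y'
    · rw [if_pos hb]; exact hμ.bound b' hb
    · rw [if_neg hb, PiLp.toLp_apply, hμ.off b' hb, abs_zero]
  have key := abs_apply_le_of_blockBound (ρ := i.tdist) f (fun b : PBond i.P 0 => iterBlockOf i.j b.src)
    (fun b : PBond i.P 0 => iterBlockOf i.j b.src) hf (WithLp.toLp 2 μ) (fun y => if y = y' then B else 0) hg0 hxg x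
  rw [onFun_apply]
  refine key.trans (le_of_eq ?_)
  simp_rw [mul_ite, mul_zero, Finset.sum_ite_eq', Finset.mem_univ, if_true]
  ring

/-! ## §3  (2.133) for the genuine two-scale `G_□`: the majorants of `G_□` and `∇_λG_□` -/

/-- **(2.133), FIRST ENTRY, FOR THE GENUINE TWO-SCALE `G_□` OF (2.90)**: there are `δ₂ > 0` and `A ≥ 0` depending on `d, L, a₀, a₁` only such that
for EVERY member `i` of the two-scale family (every volume, scale `j + 1 ≤ m + K`, `Λ′ ⊂ T^{(j+1)}`, weights in the window) the transported
`G_□` has the majorant `A·e^{−δ₂|y − y′|_T}` on the geometry `tsGeo i R M`: `|(G_□μ)(x)| ≤ A·e^{−δ₂|y(x) − y′|_T}·B` whenever `supp μ ⊂ B(y′)`,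
`|μ| ≤ B` — p22's `blockBound_G_scaling` (Prop. 2.5, (1.110)₁) BY NAME.
[cite: Balaban1984PropagatorsII, (2.133) p.247; Prop. 2.5 p.246] -/
theorem ineq2133_G (d L : ℕ) (hd : 1 ≤ d + 1) (hL : Odd L ∧ 1 < L) {a₀ a₁ : ℝ} (ha₀ : 0 < a₀) (ha₁ : a₀ ≤ a₁) :
    ∃ δ : ℝ, 0 < δ ∧ ∃ A : ℝ, 0 ≤ A ∧ ∀ (i : TSIdx d L hd hL a₀ a₁) (R M : ℝ),
      HasMajorant (g := tsGeo i R M) (fun b : PBond i.P 0 => iterBlockOf i.j b.src) (onFun i.D.G)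
        (fun y y' => A * Real.exp (-(δ * i.tdist y y'))) := by
  obtain ⟨δ, hδ, C, hC, h⟩ := blockBound_G_scaling d L hd hL ha₀ ha₁
  refine ⟨δ, hδ, C, hC, fun i R M => hasMajorant_of_blockBound i R M i.D.G fun b y => ?_⟩
  exact h i.m i.K i.j i.hc i.hj i.Λ' i.w i.hw0 i.hw1 b y

/-- **(2.133), SECOND ENTRY** (*"|(∇G_□J)(x)|"*): the same for `∇_λG_□`, every direction `λ` (`∇_λ = L^j(S_λ − I)`, r03's `TSIdx.Dl`), ONE
`(δ₂, A)` for all members and directions — p22's `blockBound_DG_scaling` (Prop. 2.5, (1.110)₂) BY NAME.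
[cite: Balaban1984PropagatorsII, (2.133) p.247; Prop. 2.5 p.246] -/
theorem ineq2133_DG (d L : ℕ) (hd : 1 ≤ d + 1) (hL : Odd L ∧ 1 < L) {a₀ a₁ : ℝ} (ha₀ : 0 < a₀) (ha₁ : a₀ ≤ a₁) :
    ∃ δ : ℝ, 0 < δ ∧ ∃ A : ℝ, 0 ≤ A ∧ ∀ (i : TSIdx d L hd hL a₀ a₁) (R M : ℝ) (lam : Fin i.P.d),
      HasMajorant (g := tsGeo i R M) (fun b : PBond i.P 0 => iterBlockOf i.j b.src) (onFun (i.Dl lam ∘ₗ i.D.G))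
        (fun y y' => A * Real.exp (-(δ * i.tdist y y'))) := by
  obtain ⟨δ, hδ, C, hC, h⟩ := blockBound_DG_scaling d L hd hL ha₀ ha₁
  refine ⟨δ, hδ, C, hC, fun i R M lam => hasMajorant_of_blockBound i R M (i.Dl lam ∘ₗ i.D.G) fun b y => ?_⟩
  exact h i.m i.K i.j i.hc i.hj i.Λ' i.w i.hw0 i.hw1 lam b y

/-- monotonicity of the exponential majorant in the constant and the rate (on non-negative distances). [folklore] -/
private theorem expMajorant_mono {A A' δ δ' t : ℝ} (hA : A ≤ A') (hA' : 0 ≤ A') (hδ : δ' ≤ δ) (ht : 0 ≤ t) :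
    A * Real.exp (-(δ * t)) ≤ A' * Real.exp (-(δ' * t)) :=
  (mul_le_mul_of_nonneg_right hA (Real.exp_nonneg _)).trans
    (mul_le_mul_of_nonneg_left (Real.exp_le_exp.mpr (neg_le_neg (mul_le_mul_of_nonneg_right hδ ht))) hA')

/-- **(2.133) FOR THE GENUINE TWO-SCALE `G_□`, BOTH ENTRIES WITH ONE PAIR OF CONSTANTS** (as printed: one `O(1)`, one `δ₂`): there are `δ₂ > 0`,
`A ≥ 0` on `d, L, a₀, a₁` only such that for every member `i` (and every `R`, `M`) `G_□` AND every `∇_λG_□` have the majorant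
`A·e^{−δ₂|y − y′|_T}` with respect to the `j`-blocks — `ineq2133_G` and `ineq2133_DG` merged by `…B6RandomWalk.hasMajorant_mono`
(`δ₂ := min`, `A := max`, `|y − y′|_T ≥ 0` by `TSIdx.tdist_nonneg`). [cite: Balaban1984PropagatorsII, (2.133) p.247; Prop. 2.5 p.246] -/
theorem ineq2133 (d L : ℕ) (hd : 1 ≤ d + 1) (hL : Odd L ∧ 1 < L) {a₀ a₁ : ℝ} (ha₀ : 0 < a₀) (ha₁ : a₀ ≤ a₁) :
    ∃ δ : ℝ, 0 < δ ∧ ∃ A : ℝ, 0 ≤ A ∧ ∀ (i : TSIdx d L hd hL a₀ a₁) (R M : ℝ),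
      HasMajorant (g := tsGeo i R M) (fun b : PBond i.P 0 => iterBlockOf i.j b.src) (onFun i.D.G)
          (fun y y' => A * Real.exp (-(δ * i.tdist y y'))) ∧
        ∀ lam : Fin i.P.d, HasMajorant (g := tsGeo i R M) (fun b : PBond i.P 0 => iterBlockOf i.j b.src) (onFun (i.Dl lam ∘ₗ i.D.G))
          (fun y y' => A * Real.exp (-(δ * i.tdist y y'))) := by
  obtain ⟨δ₁, hδ₁, A₁, hA₁, h₁⟩ := ineq2133_G d L hd hL ha₀ ha₁
  obtain ⟨δ₂, hδ₂, A₂, _, h₂⟩ := ineq2133_DG d L hd hL ha₀ ha₁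
  have hA : 0 ≤ max A₁ A₂ := hA₁.trans (le_max_left _ _)
  refine ⟨min δ₁ δ₂, lt_min hδ₁ hδ₂, max A₁ A₂, hA, fun i R M => ⟨?_, fun lam => ?_⟩⟩
  · exact B6RandomWalk.hasMajorant_mono _ (h₁ i R M) fun a b =>
      expMajorant_mono (le_max_left _ _) hA (min_le_left _ _) (i.tdist_nonneg a b)
  · exact B6RandomWalk.hasMajorant_mono _ (h₂ i R M lam) fun a b =>
      expMajorant_mono (le_max_right _ _) hA (min_le_right _ _) (i.tdist_nonneg a b)

/-! ## §4  The hypothesis `h2133` of `B6Prop26Gluing.prop26_2136_of_2133_2134_lemma21`, literally -/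

/-- **(2.133) IN THE LOCAL SHAPE OF THE GLUING STEP**: for every reach set `S ⊂ T^{(j)}` (in Prop. 2.6: the blocks in the reach `□̃` of the box),
`LocalMajorant (fun b => y(b₋)) (onFun G_□) S (fun y y′ => A·e^{−δ₂|y − y′|_T})` — the shape of the hypothesis `h2133` of
`…B6Prop26Gluing.prop26_2136_of_2133_2134_lemma21` (there `K = A·P(y)·e^{−(δ₂/2)d(y,y′)}`; here `P ≡ 1` since `L^jη = 1`, the rate renamed,
`d` = the torus distance of `tsGeo i R M`; another majorant `K′ ≥ K` by `…B6RandomWalk.hasMajorant_mono`).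
[cite: Balaban1984PropagatorsII, (2.133) p.247, p.239 («G₀ = Σ_{□∈𝒟} h_□G_□h_□»)] -/
theorem ineq2133_G_local (d L : ℕ) (hd : 1 ≤ d + 1) (hL : Odd L ∧ 1 < L) {a₀ a₁ : ℝ} (ha₀ : 0 < a₀) (ha₁ : a₀ ≤ a₁) :
    ∃ δ : ℝ, 0 < δ ∧ ∃ A : ℝ, 0 ≤ A ∧ ∀ (i : TSIdx d L hd hL a₀ a₁) (R M : ℝ) (S : Set (Site i.P i.j)),
      LocalMajorant (g := tsGeo i R M) (fun b : PBond i.P 0 => iterBlockOf i.j b.src) (onFun i.D.G) S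
        (fun y y' => A * Real.exp (-(δ * i.tdist y y'))) := by
  obtain ⟨δ, hδ, A, hA, h⟩ := ineq2133_G d L hd hL ha₀ ha₁
  exact ⟨δ, hδ, A, hA, fun i R M S => localMajorant_of_hasMajorant (g := tsGeo i R M) _ (h i R M) S⟩

/-- the local shape for `∇_λG_□`. [cite: Balaban1984PropagatorsII, (2.133) p.247] -/
theorem ineq2133_DG_local (d L : ℕ) (hd : 1 ≤ d + 1) (hL : Odd L ∧ 1 < L) {a₀ a₁ : ℝ} (ha₀ : 0 < a₀) (ha₁ : a₀ ≤ a₁) :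
    ∃ δ : ℝ, 0 < δ ∧ ∃ A : ℝ, 0 ≤ A ∧ ∀ (i : TSIdx d L hd hL a₀ a₁) (R M : ℝ) (lam : Fin i.P.d) (S : Set (Site i.P i.j)),
      LocalMajorant (g := tsGeo i R M) (fun b : PBond i.P 0 => iterBlockOf i.j b.src) (onFun (i.Dl lam ∘ₗ i.D.G)) S
        (fun y y' => A * Real.exp (-(δ * i.tdist y y'))) := by
  obtain ⟨δ, hδ, A, hA, h⟩ := ineq2133_DG d L hd hL ha₀ ha₁
  exact ⟨δ, hδ, A, hA, fun i R M lam S => localMajorant_of_hasMajorant (g := tsGeo i R M) _ (h i R M lam) S⟩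

end Literature.MathematicalPhysics.QuantumFieldTheory.Balaban1983to89.B6Ineq2133TwoScaleV1

end
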